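import Mathlib.Data.Fintype.Card
import Mathlib.Data.Fintype.Prod
import Mathlib.Algebra.BigOperators.Group.Finset.Basic
import Mathlib.Algebra.BigOperators.Ring.Finset
import Mathlib.Algebra.Order.BigOperators.Group.Finset
import Mathlib.Algebra.Group.Nat.Even
import Mathlib.Tactic.Linarith
import Mathlib.Tactic.Ring
import HarnessLib

/-!
# Mann's theorem: a Latin square of order `4t + 2` with a subsquare of order `2t + 1` has no orthogonal mate

Literature formalisation (cell `pub-namedobj`, target M = three MOLS of order 10; the printed floor fact 'a 10 × 10
Latin square with a 5 × 5 subsquare has no orthogonal mate (Mann)', Bright–Keita–Stevens 2026 §1).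

**Theorem (`no_orthogonal_mate_of_subsquare`; Mann 1944; Keedwell–Dénes, Thm. 5.1.6 (a), the case `k = 0` of
'foreign' cells).** Let `L` be a Latin square of order `2m`, `m` odd, on the symbol/row/column set `ι`, and suppose
`L` has an `m × m` subarray `R × C` all of whose entries lie in an `m`-set `S` of symbols (a Latin subsquare of order
`m`). Then `L` has no orthogonal mate.

Proof formalised (transversal count): for a mate `M` and a symbol `s`, the cells `T = {M = s}` form a transversal of
`L`; its `m` cells carrying symbols of `S` lie in `R × C` or in `Rᶜ × Cᶜ` (a row of `R` carries `S` exactly on `C`, a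
column of `C` exactly on `R`), and `|T ∩ Rᶜ × Cᶜ| = |T ∩ R × C| =: a`, so `m ≤ 2a`, i.e. `a ≥ (m+1)/2` as `m` is odd;
summing over the `2m` symbols `s` (the sets `{M = s} ∩ R × C` partition `R × C`) gives `m² ≥ m(m+1)`, absurd.

Vocabulary: a Latin square is a map `L : ι → ι → ι` with injective rows and columns (`IsLatinSquare`); `M` is an
orthogonal mate of `L` when `(L, M)` is injective on cells (`IsOrthogonalMate`). No `sorry`, no new axioms.

## References
* H. B. Mann, *On orthogonal Latin squares*, Bull. Amer. Math. Soc. 50 (1944) 249–257,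
  doi:10.1090/S0002-9904-1944-08127-5. [Mann1944OrthogonalLatinSquares]
* A. D. Keedwell, J. Dénes, *Latin Squares and their Applications*, 2nd ed., Elsevier 2015, Thm. 5.1.6 (a) (held copy
  `book:keedwellnd-latin-squares-their-applications`, chunk p. 199–200). [KeedwellDenes2015LatinSquares]
-/

namespace Literature.Combinatorics.Designs.LatinSquares

open Finset

variable {ι : Type*} [Fintype ι] [DecidableEq ι]

/-- A Latin square on the index set `ι` (rows, columns and symbols all indexed by `ι`): every row and every column
is a permutation of the symbols. [cite: KeedwellDenes2015LatinSquares, §1.1 Definition] -/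
def IsLatinSquare (L : ι → ι → ι) : Prop :=
  (∀ i, Function.Injective (L i)) ∧ (∀ j, Function.Injective fun i => L i j)

/-- `M` is an orthogonal mate of `L`: superimposing the two squares, every ordered pair of symbols occurs at most
(hence exactly) once. [cite: KeedwellDenes2015LatinSquares, §5.1 Definition] -/
def IsOrthogonalMate (L M : ι → ι → ι) : Prop :=
  Function.Injective fun p : ι × ι => (L p.1 p.2, M p.1 p.2)

omit [DecidableEq ι] in
/-- rows of a Latin square are bijections [folklore] -/
private theorem row_bijective {L : ι → ι → ι} (hL : IsLatinSquare L) (i : ι) : Function.Bijective (L i) :=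
  Finite.injective_iff_bijective.mp (hL.1 i)

omit [DecidableEq ι] in
/-- columns of a Latin square are bijections [folklore] -/
private theorem col_bijective {L : ι → ι → ι} (hL : IsLatinSquare L) (j : ι) :
    Function.Bijective fun i => L i j :=
  Finite.injective_iff_bijective.mp (hL.2 j)

omit [Fintype ι] in
/-- In a Latin square, a row of an `m × m` subarray `R × C` with entries in an `m`-set `S` carries the symbols of
`S` exactly on the columns of `C`. [cite: KeedwellDenes2015LatinSquares, Thm. 5.1.6 (a) proof] -/
private theorem mem_S_iff_col {L : ι → ι → ι} (hL : IsLatinSquare L) {R C S : Finset ι} {m : ℕ}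
    (hC : C.card = m) (hS : S.card = m) (hsub : ∀ i ∈ R, ∀ j ∈ C, L i j ∈ S) {i : ι} (hi : i ∈ R) (j : ι) :
    L i j ∈ S ↔ j ∈ C := by
  have himg : C.image (L i) = S := by
    apply Finset.eq_of_subset_of_card_le
    · intro x hx
      obtain ⟨j', hj', rfl⟩ := mem_image.mp hx
      exact hsub i hi j' hj'
    · rw [hS, Finset.card_image_of_injective _ (hL.1 i), hC]
  constructor
  · intro h
    rw [← himg, mem_image] at h
    obtain ⟨j', hj', hjj'⟩ := h
    rw [← hL.1 i hjj']; exact hj'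
  · intro hj; exact hsub i hi j hj

omit [Fintype ι] in
/-- Dually, a column of `C` carries the symbols of `S` exactly on the rows of `R`.
[cite: KeedwellDenes2015LatinSquares, Thm. 5.1.6 (a) proof] -/
private theorem mem_S_iff_row {L : ι → ι → ι} (hL : IsLatinSquare L) {R C S : Finset ι} {m : ℕ}
    (hR : R.card = m) (hS : S.card = m) (hsub : ∀ i ∈ R, ∀ j ∈ C, L i j ∈ S) {j : ι} (hj : j ∈ C) (i : ι) :
    L i j ∈ S ↔ i ∈ R := by
  have himg : R.image (fun i => L i j) = S := by
    apply Finset.eq_of_subset_of_card_le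
    · intro x hx
      obtain ⟨i', hi', rfl⟩ := mem_image.mp hx
      exact hsub i' hi' j hj
    · rw [hS, Finset.card_image_of_injective _ (hL.2 j), hR]
  constructor
  · intro h
    rw [← himg, mem_image] at h
    obtain ⟨i', hi', hii'⟩ := h
    rw [← hL.2 j hii']; exact hi'
  · intro hi; exact hsub i hi j hj

/-- **The transversal inequality.** For a mate `M` of `L`, a symbol `s`, and a subsquare `R × C` (entries in `S`,
`|R| = |C| = |S| = m`, order `2m`): the transversal `{M = s}` meets `R × C` in `a` cells with `m ≤ 2a`.
[cite: KeedwellDenes2015LatinSquares, Thm. 5.1.6 (a) proof] -/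
private theorem subsquare_transversal_bound {L M : ι → ι → ι} (hL : IsLatinSquare L) (hM : IsLatinSquare M)
    (hLM : IsOrthogonalMate L M) {R C S : Finset ι} {m : ℕ} (hR : R.card = m) (hC : C.card = m) (hS : S.card = m)
    (hsub : ∀ i ∈ R, ∀ j ∈ C, L i j ∈ S) (hn : Fintype.card ι = 2 * m) (s : ι) :
    m ≤ 2 * ((R ×ˢ C).filter fun p : ι × ι => M p.1 p.2 = s).card := by
  classical
  -- the transversal T = {M = s}
  set T := (univ : Finset (ι × ι)).filter fun p => M p.1 p.2 = s with hTdef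
  -- one cell of T in each row: T ≃ rows
  have hTrow : ∀ X : Finset ι, (T.filter fun p => p.1 ∈ X).card = X.card := by
    intro X
    -- bijection p ↦ p.1
    refine Finset.card_bij (fun p _ => p.1) (fun p hp => (mem_filter.mp hp).2) ?_ ?_
    · intro p hp q hq h
      simp only [hTdef, mem_filter, mem_univ, true_and] at hp hq
      have h2 : p.2 = q.2 := by
        apply hM.1 p.1
        rw [hp.1]; rw [h]; exact hq.1.symm
      exact Prod.ext h h2
    · intro i hi
      obtain ⟨j, hj⟩ := (row_bijective hM i).2 s
      exact ⟨(i, j), by simp [hTdef, hj, hi], rfl⟩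
  have hTcol : ∀ X : Finset ι, (T.filter fun p => p.2 ∈ X).card = X.card := by
    intro X
    refine Finset.card_bij (fun p _ => p.2) (fun p hp => (mem_filter.mp hp).2) ?_ ?_
    · intro p hp q hq h
      simp only [hTdef, mem_filter, mem_univ, true_and] at hp hq
      have h1 : p.1 = q.1 := by
        apply hM.2 p.2
        simp only
        rw [hp.1]; rw [h]; exact hq.1.symm
      exact Prod.ext h1 h
    · intro j hj
      obtain ⟨i, hi⟩ := (col_bijective hM j).2 s
      exact ⟨(i, j), by simp [hTdef, hi, hj], rfl⟩
  have hTcard : T.card = 2 * m := by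
    have := hTrow univ
    rw [Finset.card_univ, hn] at this
    rw [← this]
    congr 1; ext p; simp
  -- the L-symbols on T are all distinct, hence T carries every symbol exactly once
  have hLinj : Set.InjOn (fun p : ι × ι => L p.1 p.2) T := by
    intro p hp q hq h
    simp only [hTdef, coe_filter, mem_univ, true_and, Set.mem_setOf_eq] at hp hq
    apply hLM
    simp only [Prod.mk.injEq]
    exact ⟨h, by rw [hp, hq]⟩
  have hTS : (T.filter fun p => L p.1 p.2 ∈ S).card = m := by
    -- image of T under L is everything
    have himg : T.image (fun p : ι × ι => L p.1 p.2) = univ := by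
      apply Finset.eq_univ_of_card
      rw [Finset.card_image_of_injOn hLinj, hTcard, hn]
    rw [← hS]
    apply Finset.card_bij (fun p _ => L p.1 p.2)
    · intro p hp; exact (mem_filter.mp hp).2
    · intro p hp q hq h; exact hLinj (mem_filter.mp hp).1 (mem_filter.mp hq).1 h
    · intro x hx
      have hx' : x ∈ T.image (fun p : ι × ι => L p.1 p.2) := by rw [himg]; exact mem_univ x
      obtain ⟨p, hp, hpx⟩ := mem_image.mp hx'
      exact ⟨p, mem_filter.mpr ⟨hp, by rw [hpx]; exact hx⟩, hpx⟩
  -- the S-cells of T lie in R × C or in Rᶜ × Cᶜ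
  have hSsub : (T.filter fun p => L p.1 p.2 ∈ S) ⊆
      (T.filter fun p => p.1 ∈ R ∧ p.2 ∈ C) ∪ (T.filter fun p => p.1 ∉ R ∧ p.2 ∉ C) := by
    intro p hp
    have hpT : p ∈ T := (mem_filter.mp hp).1
    have hpS : L p.1 p.2 ∈ S := (mem_filter.mp hp).2
    by_cases h1 : p.1 ∈ R
    · exact mem_union.mpr (Or.inl (mem_filter.mpr ⟨hpT, h1, (mem_S_iff_col hL hC hS hsub h1 p.2).mp hpS⟩))
    · refine mem_union.mpr (Or.inr (mem_filter.mpr ⟨hpT, h1, fun h2 => h1 ?_⟩))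
      exact (mem_S_iff_row hL hR hS hsub h2 p.1).mp hpS
  -- sizes: |T ∩ (R × C)| = a, |T ∩ (Rᶜ × Cᶜ)| = 2m - m - m + a = a (inclusion–exclusion inside T)
  set a := ((R ×ˢ C).filter fun p : ι × ι => M p.1 p.2 = s).card with hadef
  have hA : (T.filter fun p => p.1 ∈ R ∧ p.2 ∈ C).card = a := by
    rw [hadef]; congr 1; ext p; simp [hTdef, mem_product, and_comm]
  have hE : (T.filter fun p => p.1 ∉ R ∧ p.2 ∉ C).card + m + m = 2 * m + a := by
    -- T = E ⊔ (row ∈ R) ∪ (col ∈ C), and |(row∈R) ∪ (col∈C)| = m + m - a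
    have hunion : ((T.filter fun p => p.1 ∈ R) ∪ (T.filter fun p => p.2 ∈ C)).card + a = m + m := by
      rw [← hA, Finset.filter_and, Finset.card_union_add_card_inter, hTrow R, hTcol C, hR, hC]
    have hdisj : Disjoint (T.filter fun p => p.1 ∉ R ∧ p.2 ∉ C)
        ((T.filter fun p => p.1 ∈ R) ∪ (T.filter fun p => p.2 ∈ C)) := by
      rw [Finset.disjoint_left]
      intro p hp hq
      have hp' := (mem_filter.mp hp).2
      rcases mem_union.mp hq with hq | hq
      · exact hp'.1 (mem_filter.mp hq).2
      · exact hp'.2 (mem_filter.mp hq).2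
    have hcover : (T.filter fun p => p.1 ∉ R ∧ p.2 ∉ C) ∪
        ((T.filter fun p => p.1 ∈ R) ∪ (T.filter fun p => p.2 ∈ C)) = T := by
      ext p
      simp only [mem_union, mem_filter]
      constructor
      · rintro (⟨h, -⟩ | ⟨h, -⟩ | ⟨h, -⟩) <;> exact h
      · intro hp
        by_cases h1 : p.1 ∈ R
        · exact Or.inr (Or.inl ⟨hp, h1⟩)
        · by_cases h2 : p.2 ∈ C
          · exact Or.inr (Or.inr ⟨hp, h2⟩)
          · exact Or.inl ⟨hp, h1, h2⟩
    have := Finset.card_union_of_disjoint hdisj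
    rw [hcover, hTcard] at this
    omega
  -- conclude: m = |S-cells of T| ≤ |A| + |E| = 2a
  have hle := Finset.card_le_card hSsub
  have hAE := Finset.card_union_le (T.filter fun p => p.1 ∈ R ∧ p.2 ∈ C) (T.filter fun p => p.1 ∉ R ∧ p.2 ∉ C)
  rw [hTS] at hle
  omega

/-- **Mann's theorem (1944), subsquare form.** A Latin square of order `2m`, `m` odd, containing an `m × m` subarray
whose entries lie in an `m`-set of symbols (a Latin subsquare of order `m`) has no orthogonal mate. In particular a
Latin square of order `10` with a subsquare of order `5` has no orthogonal mate.
[cite: KeedwellDenes2015LatinSquares, Thm. 5.1.6 (a)] [cite: Mann1944OrthogonalLatinSquares, Theorem (orthogonal mates and subsquares)] -/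
theorem no_orthogonal_mate_of_subsquare {L M : ι → ι → ι} (hL : IsLatinSquare L) (hM : IsLatinSquare M)
    (hLM : IsOrthogonalMate L M) {R C S : Finset ι} {m : ℕ} (hR : R.card = m) (hC : C.card = m) (hS : S.card = m)
    (hsub : ∀ i ∈ R, ∀ j ∈ C, L i j ∈ S) (hn : Fintype.card ι = 2 * m) (hm : Odd m) : False := by
  classical
  -- Σ_s a_s = |R × C| = m²
  have hsum : ∑ s, ((R ×ˢ C).filter fun p : ι × ι => M p.1 p.2 = s).card = m * m := by
    rw [← Finset.card_eq_sum_card_fiberwise (f := fun p : ι × ι => M p.1 p.2) (s := R ×ˢ C) (t := univ)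
      (fun _ _ => mem_univ _), Finset.card_product, hR, hC]
  -- each a_s ≥ (m+1)/2
  have hbound : ∀ s, m + 1 ≤ 2 * ((R ×ˢ C).filter fun p : ι × ι => M p.1 p.2 = s).card := by
    intro s
    have h := subsquare_transversal_bound hL hM hLM hR hC hS hsub hn s
    obtain ⟨t, ht⟩ := hm
    omega
  have htotal : Fintype.card ι * (m + 1) ≤ 2 * ∑ s, ((R ×ˢ C).filter fun p : ι × ι => M p.1 p.2 = s).card := by
    have h1 : ∑ _s : ι, (m + 1) = Fintype.card ι * (m + 1) := by
      rw [Finset.sum_const_nat fun _ _ => rfl, Finset.card_univ]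
    rw [← h1, Finset.mul_sum]
    exact Finset.sum_le_sum fun s _ => hbound s
  rw [hsum, hn] at htotal
  obtain ⟨t, ht⟩ := hm
  nlinarith

end Literature.Combinatorics.Designs.LatinSquares
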